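import Mathlib
import HarnessLib

-- provenance: harness21/H21/H21/Statements/Turb/Wave0.lean @ 681371f (interim HEAD d8f2665); M5 mechanical rewrite
/-!
# Turbulence (family `turb`), wave 0: averaging, dissipation and structure-function glue

This file belongs to `H21/Statements/Turb/` and covers the two inventory rows of the family
`turb` that are statable on Mathlib alone:

* **turb.S04** — long-time averages `⟨g⟩` (limsup / liminf / generalized Banach limit),
  energy dissipation rate `ε = ν ⟨‖∇u‖₂²⟩ / |𝕋ᵈ|`, mean-square velocity `U²`, integral
  (forcing) scale `ℓ`, Reynolds number `Re = U ℓ / ν` and dissipation coefficient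
  `β = ε ℓ / U³` (Doering–Foias, *Energy dissipation in body-forced turbulence*,
  J. Fluid Mech. 467 (2002), §2; Frisch, *Turbulence* (1995), Ch. 5).
* **turb.S19** — velocity increments, structure functions `S_p(ℓ)` (absolute and longitudinal),
  scaling exponents `ζ_p = liminf_{ℓ → 0⁺} log S_p(ℓ) / log ℓ`, the K41 prediction `ζ_p = p/3`,
  intermittency corrections, and the shell-summed energy spectrum `E(k)` on `𝕋ᵈ`
  (Frisch 1995, Ch. 6–8; Kolmogorov 1941a).

No statement of the family is skipped among those marked statable today (S04, S19); all other
rows need Leray–Hopf / weak Euler solutions on `𝕋³` and are deferred.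

## Design choices

* The flat torus is Mathlib's `UnitAddTorus ι = ι → AddCircle (1 : ℝ)` with its (global) `volume`,
  which has total mass `1`; hence the normalisation `/ |𝕋ᵈ|` of Doering–Foias is the identity and
  is omitted. The physical case is `ι = Fin 3`; everything is stated for a general `Fintype ι`.
* Mathlib has no differential calculus on `AddCircle`; directional derivatives on the torus are
  defined intrinsically as `deriv (fun t ↦ u (x + π (t • v))) 0`, where `π : (ι → ℝ) → 𝕋^ι` is the
  quotient map (`toTorus`). This carries the usual `deriv` junk value `0` at points of
  non-differentiability.
* Long-time averages are `Filter.limsup` / `Filter.liminf` in `ℝ` of the Cesàro means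
  `T⁻¹ ∫₀ᵀ g`; in `ℝ` these return the junk value `0` for unbounded mean families (Mathlib's
  `Real.sSup` convention). Generalized (Hahn–Banach) limits at `+∞` are bundled as the structure
  `GeneralizedLimit` (a `FunLike` linear functional squeezed between `liminf` and `limsup` on
  every function that is *eventually* bounded at `+∞`, hence extending the ordinary limit); all
  dissipation functionals take the averaging operation `avg : (ℝ → ℝ) → ℝ` as a parameter so
  that any of the three can be plugged in.
* Velocity fields are `u : UnitAddTorus ι → EuclideanSpace ℝ ι`, time-dependent ones
  `u : ℝ → UnitAddTorus ι → EuclideanSpace ℝ ι`. Only `t ≥ 0` matters for the averages: all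
  three averaging operations only see the germ of `T ↦ T⁻¹ ∫₀ᵀ g` at `T → +∞`.
* Directional / partial derivatives take the direction (resp. coordinate) *before* the point,
  `torusLineDeriv u v x`, `torusPartialDeriv u i x`, so that `torusLineDeriv u v` and
  `torusPartialDeriv u i` are again fields on the torus.
* Junk values of the scalar glue: `reynoldsNumber U ℓ 0 = 0`, `dissipationCoeff ε ℓ 0 = 0`
  (division convention), and `scalingExponent S` uses `Real.log`, so `S ℓ ≤ 0` contributes
  `log |S ℓ|` (`0` if `S ℓ = 0`); e.g. `S ≡ 0` gets exponent `0` rather than `+∞`. Statements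
  consuming these quantities add positivity hypotheses (as `ZerothLaw.lean` does).
-/

open MeasureTheory Filter Topology

noncomputable section

namespace Literature.Analysis.FluidPDE

variable {ι : Type*} [Fintype ι]

/-! ### The flat torus: quotient map, translations, directional derivatives -/

/-- The quotient map `ℝ^ι → 𝕋^ι = (ℝ/ℤ)^ι`, coordinatewise `AddCircle` projection
(Frisch 1995, Ch. 2: periodic box). [cite: Frisch1995, Ch. 2: periodic box] -/
def toTorus (v : ι → ℝ) : UnitAddTorus ι := fun i => (v i : UnitAddCircle)

/-- Directional derivative of a field `u` on the torus in the direction `v ∈ ℝ^ι` at `x`: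
`d/dt|_{t=0} u (x + π (t v))`. Junk value `0` where the map is not differentiable
(Frisch 1995, Ch. 2; glue replacing calculus on `AddCircle`, absent from Mathlib). The direction
comes before the point so that `torusLineDeriv u v` is a field on the torus. [cite: Frisch1995, Ch. 2] -/
def torusLineDeriv {E : Type*} [NormedAddCommGroup E] [NormedSpace ℝ E]
    (u : UnitAddTorus ι → E) (v : ι → ℝ) (x : UnitAddTorus ι) : E :=
  deriv (fun t : ℝ => u (x + toTorus (t • v))) 0

/-- Partial derivative `∂ᵢ u` of a field on the torus, i.e. the directional derivative along the
`i`-th coordinate vector (Frisch 1995, Ch. 2). [cite: Frisch1995, Ch. 2] -/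
def torusPartialDeriv [DecidableEq ι] {E : Type*} [NormedAddCommGroup E] [NormedSpace ℝ E]
    (u : UnitAddTorus ι → E) (i : ι) (x : UnitAddTorus ι) : E :=
  torusLineDeriv u (Pi.single i 1) x

/-! ### turb.S04: long-time averages -/

/-- **turb.S04** (Cesàro / running time mean; Doering–Foias, JFM 467 (2002) §2, Frisch 1995 Ch. 5).
The finite-time average `T⁻¹ ∫₀ᵀ g(t) dt` of a real function of time. [cite: Frisch1995, Ch. 5] -/
def timeMean (g : ℝ → ℝ) (T : ℝ) : ℝ := T⁻¹ * ∫ t in (0 : ℝ)..T, g t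

/-- **turb.S04** (long-time average, limsup version; Doering–Foias, JFM 467 (2002) §2).
`⟨g⟩⁺ = limsup_{T → ∞} T⁻¹ ∫₀ᵀ g`. Junk value (`Real.sSup` convention) if the running means are
unbounded. [folklore] -/
def longTimeAvgSup (g : ℝ → ℝ) : ℝ := limsup (timeMean g) atTop

/-- **turb.S04** (long-time average, liminf version; Doering–Foias, JFM 467 (2002) §2).
`⟨g⟩⁻ = liminf_{T → ∞} T⁻¹ ∫₀ᵀ g`. [folklore] -/
def longTimeAvgInf (g : ℝ → ℝ) : ℝ := liminf (timeMean g) atTop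

/-- **turb.S04** (generalized / Banach limit at `+∞`; Doering–Foias, JFM 467 (2002) §2, "Lim";
Foias–Manley–Rosa–Temam, *Navier–Stokes Equations and Turbulence* (2001), Ch. IV §1).
A linear functional `Λ` on real functions of time such that
`liminf_{t → ∞} g ≤ Λ g ≤ limsup_{t → ∞} g` for every `g` which is *eventually* bounded (above
and below) at `+∞`. In particular `Λ g = lim_{t → ∞} g (t)` whenever the limit exists
(`GeneralizedLimit.apply_eq_of_tendsto`), `Λ` is positive on eventually bounded functions and
only depends on the germ of `g` at `+∞` there. Existence follows from Hahn–Banach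
(`GeneralizedLimit.nonempty`). Values on functions unbounded near `+∞` are unconstrained. [folklore] -/
structure GeneralizedLimit where
  /-- The underlying linear functional on functions of time. -/
  toLinearMap : (ℝ → ℝ) →ₗ[ℝ] ℝ
  /-- On eventually bounded functions the generalized limit is at least the `liminf` at `+∞`. -/
  liminf_le' : ∀ g : ℝ → ℝ, IsBoundedUnder (· ≤ ·) atTop g → IsBoundedUnder (· ≥ ·) atTop g →
    liminf g atTop ≤ toLinearMap g
  /-- On eventually bounded functions the generalized limit is at most the `limsup` at `+∞`. -/
  le_limsup' : ∀ g : ℝ → ℝ, IsBoundedUnder (· ≤ ·) atTop g → IsBoundedUnder (· ≥ ·) atTop g →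
    toLinearMap g ≤ limsup g atTop

namespace GeneralizedLimit

/-- A generalized limit is determined by its underlying linear functional. [folklore] -/
theorem toLinearMap_injective : Function.Injective GeneralizedLimit.toLinearMap := by
  rintro ⟨Λ, _, _⟩ ⟨Λ', _, _⟩ h
  congr

/-- Generalized limits are bundled functions `(ℝ → ℝ) → ℝ` (Mathlib `FunLike` pattern). [folklore] -/
instance : FunLike GeneralizedLimit (ℝ → ℝ) ℝ where
  coe Λ := Λ.toLinearMap
  coe_injective _ _ h := toLinearMap_injective (LinearMap.coe_injective h)

/-- Generalized limits are `ℝ`-linear (Doering–Foias 2002, §2). [cite: DoeringFoias2002, §2] -/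
instance : LinearMapClass GeneralizedLimit ℝ (ℝ → ℝ) ℝ where
  map_add Λ := Λ.toLinearMap.map_add
  map_smulₛₗ Λ := Λ.toLinearMap.map_smul

/-- The coercion to a function is the underlying linear map. [folklore] -/
@[simp]
theorem toLinearMap_apply (Λ : GeneralizedLimit) (g : ℝ → ℝ) : Λ.toLinearMap g = Λ g := rfl

/-- The lower half of the sandwich, restated through the coercion (Doering–Foias 2002, §2). [cite: DoeringFoias2002, §2] -/
theorem liminf_le (Λ : GeneralizedLimit) {g : ℝ → ℝ} (h₁ : IsBoundedUnder (· ≤ ·) atTop g)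
    (h₂ : IsBoundedUnder (· ≥ ·) atTop g) : liminf g atTop ≤ Λ g :=
  Λ.liminf_le' g h₁ h₂

/-- The upper half of the sandwich, restated through the coercion (Doering–Foias 2002, §2). [cite: DoeringFoias2002, §2] -/
theorem le_limsup (Λ : GeneralizedLimit) {g : ℝ → ℝ} (h₁ : IsBoundedUnder (· ≤ ·) atTop g)
    (h₂ : IsBoundedUnder (· ≥ ·) atTop g) : Λ g ≤ limsup g atTop :=
  Λ.le_limsup' g h₁ h₂

/-- A generalized limit extends the ordinary limit at `+∞` (Doering–Foias 2002, §2;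
Foias–Manley–Rosa–Temam 2001, Ch. IV §1): convergent functions are eventually bounded and have
`liminf = limsup = lim`. [cite: DoeringFoias2002, §2] -/
theorem apply_eq_of_tendsto (Λ : GeneralizedLimit) {g : ℝ → ℝ} {c : ℝ}
    (hg : Tendsto g atTop (𝓝 c)) : Λ g = c :=
  le_antisymm (hg.limsup_eq ▸ Λ.le_limsup hg.isBoundedUnder_le hg.isBoundedUnder_ge)
    (hg.liminf_eq ▸ Λ.liminf_le hg.isBoundedUnder_le hg.isBoundedUnder_ge)

/-- Existence of generalized limits at `+∞` (Hahn–Banach applied to `limsup` on the subspace of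
eventually bounded functions, then any linear extension; e.g. Doering–Foias, JFM 467 (2002) §2,
Foias–Manley–Rosa–Temam, *Navier–Stokes Equations and Turbulence* (2001), Ch. IV §1). [cite: FoiasManleyRosaTemam2001, Ch. IV §1 (generalized limits via Hahn–Banach)] -/
def nonempty : Prop :=
  Nonempty GeneralizedLimit

/-- **turb.S04** (generalized long-time average; Doering–Foias, JFM 467 (2002) §2).
`⟨g⟩_Λ = Λ (T ↦ T⁻¹ ∫₀ᵀ g)`. This is the honest long-time average whenever the running means
`T⁻¹ ∫₀ᵀ g` are bounded for large `T` (e.g. `g ≥ 0` locally integrable with bounded means, the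
Leray–Hopf situation); only the behaviour of `g` on `[0, ∞)` matters then. [folklore] -/
def longTimeAvg (Λ : GeneralizedLimit) (g : ℝ → ℝ) : ℝ := Λ (timeMean g)

/-- The generalized long-time average agrees with `lim_{T → ∞} T⁻¹ ∫₀ᵀ g` when the latter exists
(Doering–Foias 2002, §2). [cite: DoeringFoias2002, §2] -/
theorem longTimeAvg_eq_of_tendsto (Λ : GeneralizedLimit) {g : ℝ → ℝ} {c : ℝ}
    (hg : Tendsto (timeMean g) atTop (𝓝 c)) : Λ.longTimeAvg g = c :=
  Λ.apply_eq_of_tendsto hg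

end GeneralizedLimit

/-! ### turb.S04: energy, dissipation rate, `U`, `Re`, `β` -/

section Dissipation

variable [DecidableEq ι]

/-- **turb.S04** (kinetic energy; Doering–Foias, JFM 467 (2002) §2, Frisch 1995 Ch. 5).
`E(u) = ½ ∫_{𝕋} |u(x)|² dx` for a velocity field on the unit torus. [cite: Frisch1995, Ch. 5] -/
def TurbWave0.kineticEnergy (u : UnitAddTorus ι → EuclideanSpace ℝ ι) : ℝ :=
  2⁻¹ * ∫ x, ‖u x‖ ^ 2

/-- **turb.S04** (squared `L²` norm of the velocity gradient; Doering–Foias, JFM 467 (2002) §2).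
`‖∇u‖₂² = ∫_{𝕋} ∑ᵢ |∂ᵢ u(x)|² dx` (Frobenius norm of the gradient), i.e. twice the enstrophy for
divergence-free `u`. [folklore] -/
def TurbWave0.gradNormSq (u : UnitAddTorus ι → EuclideanSpace ℝ ι) : ℝ :=
  ∫ x, ∑ i, ‖torusPartialDeriv u i x‖ ^ 2

/-- **turb.S04** (enstrophy; Frisch 1995 Ch. 2, Doering–Foias, JFM 467 (2002) §2).
`Ω(u) = ½ ‖∇u‖₂²`. [cite: Frisch1995, Ch. 2  Doering–Foias  JFM 467 (2002] -/
def enstrophy (u : UnitAddTorus ι → EuclideanSpace ℝ ι) : ℝ :=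
  2⁻¹ * TurbWave0.gradNormSq u

variable (avg : (ℝ → ℝ) → ℝ)

/-- **turb.S04** (time-averaged energy dissipation rate per unit mass; Doering–Foias, JFM 467
(2002) §2, eq. for `ε`; Frisch 1995 Ch. 5). `ε = ν ⟨‖∇u(t)‖₂²⟩ / |𝕋ᵈ|` with `|𝕋ᵈ| = 1`; the
averaging operation `avg` (e.g. `longTimeAvgSup`, `longTimeAvgInf`, `Λ.longTimeAvg`) is a
parameter. [cite: Frisch1995, Ch. 5] -/
def dissipationRate (ν : ℝ) (u : ℝ → UnitAddTorus ι → EuclideanSpace ℝ ι) : ℝ :=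
  ν * avg (fun t => TurbWave0.gradNormSq (u t))

/-- **turb.S04** (mean-square velocity `U²`; Doering–Foias, JFM 467 (2002) §2).
`U² = ⟨‖u(t)‖₂²⟩ / |𝕋ᵈ|` with `|𝕋ᵈ| = 1`. [folklore] -/
def meanSqVelocity (u : ℝ → UnitAddTorus ι → EuclideanSpace ℝ ι) : ℝ :=
  avg (fun t => ∫ x, ‖u t x‖ ^ 2)

/-- **turb.S04** (root-mean-square velocity `U`; Doering–Foias, JFM 467 (2002) §2).
`U = (⟨‖u(t)‖₂²⟩ / |𝕋ᵈ|)^{1/2}`. [folklore] -/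
def rmsVelocity (u : ℝ → UnitAddTorus ι → EuclideanSpace ℝ ι) : ℝ :=
  √(meanSqVelocity avg u)

/-- **turb.S04** (Reynolds number; Doering–Foias, JFM 467 (2002) §2). `Re = U ℓ / ν`, where `ℓ`
is the integral (forcing) length scale, an external parameter (`ℓ ≤ 1` on the unit torus).
Junk value `0` for `ν = 0` (division convention). [folklore] -/
def reynoldsNumber (U ℓ ν : ℝ) : ℝ := U * ℓ / ν

/-- **turb.S04** (dimensionless dissipation coefficient; Doering–Foias, JFM 467 (2002) §2).
`β = ε ℓ / U³`. Junk value `0` for `U = 0` (division convention). [folklore] -/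
def dissipationCoeff (ε ℓ U : ℝ) : ℝ := ε * ℓ / U ^ 3

/-- **turb.S04** (Reynolds number of a time-dependent flow; Doering–Foias, JFM 467 (2002) §2).
`Re(u) = U(u) ℓ / ν` with `U` the r.m.s. velocity w.r.t. the averaging operation `avg`. [folklore] -/
def flowReynoldsNumber (ν ℓ : ℝ) (u : ℝ → UnitAddTorus ι → EuclideanSpace ℝ ι) : ℝ :=
  reynoldsNumber (rmsVelocity avg u) ℓ ν

/-- **turb.S04** (dissipation coefficient of a time-dependent flow; Doering–Foias, JFM 467 (2002)
§2). `β(u) = ε(u) ℓ / U(u)³`. [folklore] -/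
def flowDissipationCoeff (ν ℓ : ℝ) (u : ℝ → UnitAddTorus ι → EuclideanSpace ℝ ι) : ℝ :=
  dissipationCoeff (dissipationRate avg ν u) ℓ (rmsVelocity avg u)

end Dissipation

/-! ### turb.S19: structure functions, scaling exponents, K41, energy spectrum -/

section StructureFunctions

/-- **turb.S19** (velocity increment; Frisch 1995, §6.1). `δu(x; r) = u(x + r) - u(x)` for a
separation vector `r ∈ ℝ^ι` acting on the torus by translation. [cite: Frisch1995, §6.1] -/
def velocityIncrement {E : Type*} [AddCommGroup E] (u : UnitAddTorus ι → E) (r : ι → ℝ)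
    (x : UnitAddTorus ι) : E :=
  u (x + toTorus r) - u x

/-- **turb.S19** (space-averaged absolute structure function of order `p`; Frisch 1995, §6.1 and
Ch. 8). `S_p(u; e, ℓ) = ∫_{𝕋} |u(x + ℓ e) - u(x)|^p dx` for a unit vector `e` and separation
`ℓ`. [cite: Frisch1995, §6.1 and Ch. 8] -/
def structureFunction (p : ℝ) (u : UnitAddTorus ι → EuclideanSpace ℝ ι)
    (e : EuclideanSpace ℝ ι) (ℓ : ℝ) : ℝ :=
  ∫ x, ‖velocityIncrement u (ℓ • ⇑e) x‖ ^ p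

/-- **turb.S19** (space-averaged longitudinal structure function of (integer) order `p`; Frisch
1995, §6.1, eq. (6.5), and the four-fifths law §6.2). `S_p^∥(u; e, ℓ) = ∫_{𝕋} ((u(x + ℓ e) -
u(x)) · e)^p dx`. [folklore] -/
def longitudinalStructureFunction (p : ℕ) (u : UnitAddTorus ι → EuclideanSpace ℝ ι)
    (e : EuclideanSpace ℝ ι) (ℓ : ℝ) : ℝ :=
  ∫ x, (inner ℝ (velocityIncrement u (ℓ • ⇑e) x) e) ^ p

/-- **turb.S19** (time-averaged structure function of a time-dependent flow; Frisch 1995, Ch. 6–8).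
`⟨S_p(u(t); e, ℓ)⟩` for an averaging operation `avg` (e.g. `longTimeAvgSup`). [cite: Frisch1995, Ch. 6–8] -/
def avgStructureFunction (avg : (ℝ → ℝ) → ℝ) (p : ℝ)
    (u : ℝ → UnitAddTorus ι → EuclideanSpace ℝ ι) (e : EuclideanSpace ℝ ι) (ℓ : ℝ) : ℝ :=
  avg (fun t => structureFunction p (u t) e ℓ)

/-- **turb.S19** (scaling exponent; Frisch 1995, §8.1). For a function `S` of the scale `ℓ`,
`ζ(S) = liminf_{ℓ → 0⁺} log S(ℓ) / log ℓ`, the largest `ζ` with `S(ℓ) ≲ ℓ^{ζ - o(1)}`.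
Junk values: the `liminf` is taken in `ℝ` (`0` if the quotient is unbounded near `0⁺`), and
`Real.log (S ℓ) = log |S ℓ|` (`= 0` for `S ℓ = 0`), so the definition is only meaningful for
`S > 0` near `0⁺`; e.g. `S ≡ 0` gets `ζ = 0` instead of `+∞`. [cite: Frisch1995, §8.1] -/
def scalingExponent (S : ℝ → ℝ) : ℝ :=
  liminf (fun ℓ => Real.log (S ℓ) / Real.log ℓ) (𝓝[>] 0)

/-- **turb.S19** (structure-function exponents `ζ_p`; Frisch 1995, §8.1).
`ζ_p = liminf_{ℓ → 0⁺} log S_p(ℓ) / log ℓ` for a family `S : p ↦ S_p` of structure functions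
(same junk values as `scalingExponent`). [cite: Frisch1995, §8.1] -/
def structureExponent (S : ℝ → ℝ → ℝ) (p : ℝ) : ℝ := scalingExponent (S p)

/-- **turb.S19** (Kolmogorov 1941 scaling; Kolmogorov 1941a, Frisch 1995 §6.3). The K41
prediction `ζ_p = p / 3` for all orders `p ≥ 0` of a family of structure functions. [cite: Kolmogorov1941, scaling] -/
def IsK41Scaling (S : ℝ → ℝ → ℝ) : Prop := ∀ p : ℝ, 0 ≤ p → structureExponent S p = p / 3

/-- **turb.S19** (intermittency correction; Frisch 1995, §8.1–8.3). The deviation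
`p / 3 - ζ_p` of the measured exponent from the K41 value. [cite: Frisch1995, §8.1–8.3] -/
def intermittencyCorrection (S : ℝ → ℝ → ℝ) (p : ℝ) : ℝ := p / 3 - structureExponent S p

/-- Euclidean length `|n| = (∑ᵢ nᵢ²)^{1/2}` of a wave vector `n ∈ ℤ^ι` (Frisch 1995, §6.4);
equals `‖Torus.latticeVec n‖` of `Literature.Prelude.Sobolev.FlatTorus` (not imported here to keep
this wave-0 file on Mathlib alone). [cite: Frisch1995, §6.4] -/
def waveNumber (n : ι → ℤ) : ℝ := √(∑ i, (n i : ℝ) ^ 2)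

/-- The `k`-th Fourier shell `{n ∈ ℤ^ι | k ≤ |n| < k + 1}` (Frisch 1995, §6.4). [cite: Frisch1995, §6.4] -/
def fourierShell (k : ℕ) : Set (ι → ℤ) := {n | (k : ℝ) ≤ waveNumber n ∧ waveNumber n < k + 1}

/-- Fourier coefficients `û(n) ∈ ℂ^ι` of a real vector field on the torus, taken componentwise via
Mathlib's `UnitAddTorus.mFourierCoeff` (Frisch 1995, §6.4). [cite: Frisch1995, §6.4] -/
def velocityFourierCoeff (u : UnitAddTorus ι → EuclideanSpace ℝ ι) (n : ι → ℤ) :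
    EuclideanSpace ℂ ι :=
  WithLp.toLp 2 fun j => UnitAddTorus.mFourierCoeff (fun x => (u x j : ℂ)) n

/-- **turb.S19** (shell-summed energy spectrum; Frisch 1995, §6.4, and Kolmogorov 1941a).
`E(k) = ½ ∑_{k ≤ |n| < k+1} |û(n)|²`, so that `∑ₖ E(k) = ½ ‖u‖₂²` by Parseval. [cite: Frisch1995, §6.4  and Kolmogorov 1941a] -/
def energySpectrum (u : UnitAddTorus ι → EuclideanSpace ℝ ι) (k : ℕ) : ℝ :=
  2⁻¹ * ∑' n : ι → ℤ, (fourierShell k).indicator (fun n => ‖velocityFourierCoeff u n‖ ^ 2) n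

end StructureFunctions

/-! ### Existence of generalized limits (discharge of `GeneralizedLimit.nonempty`) -/

namespace GeneralizedLimit

/-- The real functions of time converging along a filter `U` on `ℝ` form an `ℝ`-submodule of
`ℝ → ℝ` (limits of sums and scalar multiples). Auxiliary for `GeneralizedLimit.nonempty_holds`,
where `U` is an ultrafilter finer than `atTop`. [folklore] -/
def convergentSubmodule (U : Filter ℝ) : Submodule ℝ (ℝ → ℝ) where
  carrier := {g | ∃ c, Tendsto g U (𝓝 c)}
  add_mem' := by
    rintro g h ⟨a, ha⟩ ⟨b, hb⟩
    exact ⟨a + b, ha.add hb⟩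
  zero_mem' := ⟨0, tendsto_const_nhds⟩
  smul_mem' := by
    rintro c g ⟨a, ha⟩
    exact ⟨c • a, ha.const_smul c⟩

/-- Membership in `convergentSubmodule U` is convergence along `U`. [folklore] -/
theorem mem_convergentSubmodule {U : Filter ℝ} {g : ℝ → ℝ} :
    g ∈ convergentSubmodule U ↔ ∃ c, Tendsto g U (𝓝 c) :=
  Iff.rfl

/-- The limit along a non-trivial filter `U` on `ℝ`, as an `ℝ`-linear functional on the submodule
of functions converging along `U` (`limUnder`, well defined by uniqueness of limits in `ℝ`).
Auxiliary for `GeneralizedLimit.nonempty_holds`. [folklore] -/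
def limAlong (U : Filter ℝ) [U.NeBot] : convergentSubmodule U →ₗ[ℝ] ℝ where
  toFun g := limUnder U (g : ℝ → ℝ)
  map_add' g h := by
    obtain ⟨a, ha⟩ := g.2
    obtain ⟨b, hb⟩ := h.2
    have hab : Tendsto ((g + h : convergentSubmodule U) : ℝ → ℝ) U (𝓝 (a + b)) := ha.add hb
    rw [ha.limUnder_eq, hb.limUnder_eq, hab.limUnder_eq]
  map_smul' c g := by
    obtain ⟨a, ha⟩ := g.2
    have hca : Tendsto ((c • g : convergentSubmodule U) : ℝ → ℝ) U (𝓝 (c • a)) := ha.const_smul c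
    rw [ha.limUnder_eq, hca.limUnder_eq, RingHom.id_apply]

/-- `limAlong U` evaluates to `limUnder U`. [folklore] -/
@[simp]
theorem limAlong_apply (U : Filter ℝ) [U.NeBot] (g : convergentSubmodule U) :
    limAlong U g = limUnder U (g : ℝ → ℝ) :=
  rfl

/-- On a function converging along `U`, `limAlong U` returns the limit. [folklore] -/
theorem limAlong_eq_of_tendsto (U : Filter ℝ) [U.NeBot] {g : ℝ → ℝ} {c : ℝ}
    (h : Tendsto g U (𝓝 c)) : limAlong U ⟨g, ⟨c, h⟩⟩ = c :=
  h.limUnder_eq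

/-- Discharge of the named fact `GeneralizedLimit.nonempty`: **generalized (Banach) limits at `+∞`
exist** (Foias–Manley–Rosa–Temam, *Navier–Stokes Equations and Turbulence* (2001), Ch. IV
§1.3, Definition 1.4 and property (1.37) `liminf ≤ Lim ≤ limsup`; existence proved in Ch. IV
Appendix A.2 via the Hahn–Banach theorem (Thm. A.8) applied to the gauge `p(g) = limsup g`
(A.5)–(A.6)). The Lean proof replaces the Hahn–Banach step by an equivalent choice principle:
fix an ultrafilter `𝒰` finer than `atTop` (`Ultrafilter.of`); a function eventually valued in
`[a, b]` converges along `𝒰` to some `c ∈ [a, b]` (compactness, `IsCompact.ultrafilter_le_nhds'`),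
and `liminf_{+∞} g ≤ c ≤ limsup_{+∞} g` because `g < m` eventually at `+∞` for every
`m > limsup g` (`Filter.eventually_lt_of_limsup_lt`), hence eventually along `𝒰 ≤ atTop`, and
dually. The `𝒰`-limit is linear on the submodule of `𝒰`-convergent functions (`limAlong`), and any
linear extension to all of `ℝ → ℝ` (`LinearMap.exists_extend`, i.e. a Hamel-basis complement) is a
`GeneralizedLimit`. [cite: FoiasManleyRosaTemam2001, Ch. IV §1.3 Def. 1.4 & (1.37); App. A.2] -/
theorem nonempty_holds : nonempty := by
  classical
  unfold nonempty
  -- an ultrafilter refining `atTop`, and a linear extension of the limit along it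
  set 𝒰 : Ultrafilter ℝ := Ultrafilter.of atTop
  have h𝒰 : (↑𝒰 : Filter ℝ) ≤ atTop := Ultrafilter.of_le atTop
  obtain ⟨Λ, hΛ⟩ := LinearMap.exists_extend (limAlong (↑𝒰 : Filter ℝ))
  -- every eventually bounded function converges along `𝒰` to a point of `[liminf, limsup]`,
  -- and `Λ` returns that limit
  have key : ∀ g : ℝ → ℝ, IsBoundedUnder (· ≤ ·) atTop g → IsBoundedUnder (· ≥ ·) atTop g →
      ∃ c, liminf g atTop ≤ c ∧ c ≤ limsup g atTop ∧ Λ g = c := by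
    intro g h₁ h₂
    obtain ⟨b, hb⟩ := id h₁
    obtain ⟨a, ha⟩ := id h₂
    have hb' : ∀ᶠ t in atTop, g t ≤ b := hb
    have ha' : ∀ᶠ t in atTop, a ≤ g t := ha
    have hmem : ∀ᶠ t in (↑𝒰 : Filter ℝ), g t ∈ Set.Icc a b :=
      (by filter_upwards [ha', hb'] with t hta htb using ⟨hta, htb⟩ :
        ∀ᶠ t in atTop, g t ∈ Set.Icc a b).filter_mono h𝒰
    obtain ⟨c, -, hc⟩ := isCompact_Icc.ultrafilter_le_nhds' (𝒰.map g) (mem_map.1 hmem)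
    have hcT : Tendsto g (↑𝒰 : Filter ℝ) (𝓝 c) := hc
    refine ⟨c, ?_, ?_, ?_⟩
    · refine le_of_forall_lt_imp_le_of_dense fun m hm => ?_
      exact ge_of_tendsto hcT
        (((eventually_lt_of_lt_liminf hm h₂).filter_mono h𝒰).mono fun t ht => ht.le)
    · refine le_of_forall_gt_imp_ge_of_dense fun m hm => ?_
      exact le_of_tendsto hcT
        (((eventually_lt_of_limsup_lt hm h₁).filter_mono h𝒰).mono fun t ht => ht.le)
    · have hΛg := LinearMap.congr_fun hΛ ⟨g, ⟨c, hcT⟩⟩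
      rw [LinearMap.comp_apply, Submodule.subtype_apply] at hΛg
      exact hΛg.trans (limAlong_eq_of_tendsto _ hcT)
  refine ⟨⟨Λ, fun g h₁ h₂ => ?_, fun g h₁ h₂ => ?_⟩⟩
  · obtain ⟨c, hc₁, -, hc₃⟩ := key g h₁ h₂
    rw [hc₃]
    exact hc₁
  · obtain ⟨c, -, hc₂, hc₃⟩ := key g h₁ h₂
    rw [hc₃]
    exact hc₂

end GeneralizedLimit

end Literature.Analysis.FluidPDE
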